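import Literature.NumberTheory.Automorphic.UnitaryGroupArthurTraceEllipticOrbitalTwo
import Literature.NumberTheory.Automorphic.UnitaryGroupTruncatedKernelClassSumOfSupportTwo
import Literature.NumberTheory.Automorphic.UnitaryGroupLineUnipotentTwo
import HarnessLib

/-!
# The fine `𝔬`-expansion of Arthur's truncated trace on `U(J₂)` of a CM field for an ARBITRARY admissible class
# map with a finite live set (the `N = 2` twin of ★ `UnitaryGroupArthurTraceOfClassMap`): `J^T(f) = Σ_𝔬 p_𝔬(log T)`, `J(f) = Σ_{𝔬 ∩ B = ∅} (orbital integrals) + Σ_{𝔬 ∩ B ≠ ∅} p_𝔬(0)`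
(Rogawski, *Automorphic Representations of Unitary Groups in Three Variables* (1990), §2.2–2.3 pp. 13–14; Arthur,
*A trace formula for reductive groups I*, Duke Math. J. 45 (1978), Thm. 7.1, §8; Arthur, *The trace formula in
invariant form*, Ann. of Math. 114 (1981), Prop. 2.3; Shokranian (1992), §5.2: the expansion and its fine form hold
for the partition of `G(F)` into the classes `𝔬` — any conjugation-invariant, `N(F)`-saturated partition refining
«same semisimple part up to stable conjugacy» may be used, the statements summing to coarser ones.)

Topic `NumberTheory/Automorphic`; namespace `Literature.NumberTheory.Automorphic.UnitaryGroup`. THEOREMS ONLY over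
accepted tree modules: no definition, no named fact, no instance, no notation, no `sorry`. H-side copy of LAWS 1–5 for the endoscopic group `H = U(Φ₂) × U(Φ₁)` of the line
`Cruxes/H413/Lines/F0_T1InnerFormTraceIdentity.lean` (cell hodgecm-mathlib, crux H413; census `CENSUS-LAWS-Hside` §3 LAW 3∕5,
sibling `ArthurTraceOfClassMapTwo`; proofs verbatim from the `N = 3` file, the compactly contained fundamental domain of
`N(L⁺)∖N(𝔸)` now being Tate's domain on the line ★ `isFundamentalDomain_image_traceZeroFundamentalDomain_two` (H-B1a)).

The CM closers of the road — ★ `truncatedTrace_eq_sum_truncatedTraceClass_charpoly_two_cm`, ★ LAW 3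
`truncatedTrace_eq_sum_eval_classPolynomial_charpoly_cm_two` ∕ `arthurTrace_eq_sum_classPolynomial_eval_zero_charpoly_cm_two`,
★ `arthurTrace_eq_sum_offBorel_add_sum_charpoly_cm_two`, ★ LAW 4 fold `arthurTrace_eq_sum_orbital_add_sum_charpoly_cm_two`
— are stated for the characteristic-polynomial class map. Their generic inputs (★ `truncatedKernelClassIntegrable_cm_two`,
★ `truncatedKernel_eq_sum_truncatedKernelClass_of_tsupport_two`, ★ `truncatedTraceClassPolynomial_two_cm`, ★
`classPolynomial_eq_C_of_forall_ne`, ★ `truncatedTraceClass_eq_mul_tsum_covol_mul_orbitalIntegral_cm_two`) hold for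
ANY class map `cl : G(L⁺) → ι` with `IsConjInvariant cl`, `IsUnipotentInvariantOnBorel cl`. This file re-runs the
four closers for such a `cl`, given a FINITE LIVE SET `S` with the two coverings of ★
`truncatedKernel_eq_sum_truncatedKernelClass_of_tsupport_two` (`cl γ ∈ S` whenever a conjugate of `γ`, resp. of `β u`
for `β ∈ B(L⁺)`, `u ∈ N(𝔸)`, meets `tsupport f`) — so that every admissible refinement of the partition (the
Borel-refined map of ★ `UnitaryGroupBorelRefinedClassMap`, Arthur's semisimple-part classes, …) gets the fine
expansion by instantiation:

* §1 **`truncatedTrace_eq_sum_truncatedTraceClass_cm_of_covering_two`** — `J^T(f) = Σ_{𝔬 ∈ S} J^T_𝔬(f)` above a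
  threshold, with per-class integrability and the pointwise expansion of `k^T`.
* §2 **`truncatedTrace_eq_sum_eval_classPolynomial_cm_of_covering_two`**,
  **`arthurTrace_eq_sum_classPolynomial_eval_zero_cm_of_covering_two`** — LAW 3: class polynomials of degree `≤ 1`,
  `J^T(f) = Σ_{𝔬 ∈ S} p_𝔬(log T)`, `Σ p_𝔬` is Arthur's polynomial, `J(f) = Σ_{𝔬 ∈ S} p_𝔬(0)`.
* §3 **`arthurTrace_eq_sum_offBorel_add_sum_cm_of_covering_two`** — off `B(L⁺)` the class polynomials are the
  constants `C (J^T_𝔬(f))`; `J(f) = Σ_{𝔬 ∈ S, 𝔬 ∩ B = ∅} J^T_𝔬(f) + Σ_{𝔬 ∈ S, 𝔬 ∩ B ≠ ∅} p_𝔬(0)`.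
* §4 **`arthurTrace_eq_sum_orbital_add_sum_cm_of_covering_two`** — LAW 4 fold: the first sum as orbital integrals with
  covolume weights, `J(f) = Σ_{𝔬 ∩ B = ∅} c_μ Σ'_{s ⊆ 𝔬} vol · Φ_{ν∕ν_s}(γ_s, f) + Σ_{𝔬 ∩ B ≠ ∅} p_𝔬(0)`.

## References

* J. D. Rogawski, *Automorphic Representations of Unitary Groups in Three Variables*, Ann. of Math. Stud. 123 (1990),
  §2.2–2.3 (pp. 13–14) [Rogawski1990].
* J. Arthur, *A trace formula for reductive groups I*, Duke Math. J. 45 (1978), Thm. 7.1, §8 [Arthur1978TraceFormulaI].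
* J. Arthur, *The trace formula in invariant form*, Ann. of Math. 114 (1981), Prop. 2.3
  [Arthur1981TraceFormulaInvariantForm].
* S. Shokranian, *The Selberg–Arthur Trace Formula*, LNM 1503 (1992), Thm. (5.7), §5.2 [Shokranian1992].
-/
set_option autoImplicit false

noncomputable section

open MeasureTheory Measure NumberField NumberField.mixedEmbedding IsDedekindDomain Set Polynomial Topology
open Literature.MeasureTheory.Group
open scoped NNReal ENNReal Pointwise MatrixGroups Classical

namespace Literature.NumberTheory.Automorphic

namespace UnitaryGroup

universe u

/-! ## §1 The coarse expansion `J^T(f) = Σ_{𝔬 ∈ S} J^T_𝔬(f)` for an admissible class map with a finite live set -/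

/-- **`J^T(f) = Σ_{𝔬 ∈ S} J^T_𝔬(f)` for an arbitrary admissible class map** at the CM pair `(L⁺, L, complexConj)`:
for a conjugation-invariant, `N(L⁺)`-saturated `cl : G(L⁺) → ι` and a finite `S ⊆ ι` carrying the two coverings
(`cl γ ∈ S` when `x⁻¹ γ x ∈ tsupport f`; `cl β ∈ S` when `y⁻¹ β u y ∈ tsupport f`, `β ∈ B(L⁺)`, `u ∈ N(𝔸)`), there is
`T₀` with, for all `T > T₀`: every `k^T_𝔬` (`𝔬 ∈ S`) is `μ`-integrable (★ `truncatedKernelClassIntegrable_cm_two`),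
`k^T = Σ_{𝔬 ∈ S} k^T_𝔬` pointwise (★ `truncatedKernel_eq_sum_truncatedKernelClass_of_tsupport_two` at Tate's compactly
contained fundamental domain on the line, moved by FD-independence), and `J^T(f) = Σ_{𝔬 ∈ S} J^T_𝔬(f)` — the proof of ★
`truncatedTrace_eq_sum_truncatedTraceClass_charpoly_two_cm` with `(cl, S)` abstracted. [cite: Rogawski1990, §2.2 (p. 13)]
[cite: Arthur1978TraceFormulaI, Thm. 7.1] [cite: Shokranian1992, §5.2] -/
theorem truncatedTrace_eq_sum_truncatedTraceClass_cm_of_covering_two (L : Type) [Field L] [NumberField L] [IsCMField L]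
    {ι : Type u} {cl : ↥(quasiSplit (↥(maximalRealSubfield L)) L (IsCMField.complexConj L) 2).arithmeticSubgroup → ι} (hcl : IsConjInvariant cl)
    (hclN : IsUnipotentInvariantOnBorel (↥(maximalRealSubfield L)) L (IsCMField.complexConj L) 2 cl) :
    ∀ [MeasurableSpace (adelicUnipotent (↥(maximalRealSubfield L)) L (IsCMField.complexConj L) 2)]
      [BorelSpace (adelicUnipotent (↥(maximalRealSubfield L)) L (IsCMField.complexConj L) 2)]
      (ν : Measure (adelicUnipotent (↥(maximalRealSubfield L)) L (IsCMField.complexConj L) 2)) [ν.IsHaarMeasure]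
      (𝓕 : Set (adelicUnipotent (↥(maximalRealSubfield L)) L (IsCMField.complexConj L) 2)),
      IsFundamentalDomain (rationalUnipotent (↥(maximalRealSubfield L)) L (IsCMField.complexConj L) 2) 𝓕 ν →
        ∀ (μ : Measure (quasiSplit (↥(maximalRealSubfield L)) L (IsCMField.complexConj L) 2).automorphicQuotient)
          [(quasiSplit (↥(maximalRealSubfield L)) L (IsCMField.complexConj L) 2).IsAutomorphicMeasure μ]
          (f : (quasiSplit (↥(maximalRealSubfield L)) L (IsCMField.complexConj L) 2).Adelic → ℂ),
          IsQuasiSplitTest (↥(maximalRealSubfield L)) L (IsCMField.complexConj L) 2 f →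
          ∀ (S : Finset ι),
            (∀ (γ : ↥(quasiSplit (↥(maximalRealSubfield L)) L (IsCMField.complexConj L) 2).arithmeticSubgroup) (x : (quasiSplit (↥(maximalRealSubfield L)) L (IsCMField.complexConj L) 2).Adelic),
              x⁻¹ * (γ : (quasiSplit (↥(maximalRealSubfield L)) L (IsCMField.complexConj L) 2).Adelic) * x ∈ tsupport f → cl γ ∈ S) →
            (∀ (β : ↥(arithmeticBorel (↥(maximalRealSubfield L)) L (IsCMField.complexConj L) 2)) (u : ↥(adelicUnipotent (↥(maximalRealSubfield L)) L (IsCMField.complexConj L) 2)) (y : (quasiSplit (↥(maximalRealSubfield L)) L (IsCMField.complexConj L) 2).Adelic),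
              y⁻¹ * (((β : ↥(quasiSplit (↥(maximalRealSubfield L)) L (IsCMField.complexConj L) 2).arithmeticSubgroup)) : (quasiSplit (↥(maximalRealSubfield L)) L (IsCMField.complexConj L) 2).Adelic) * ((u : (quasiSplit (↥(maximalRealSubfield L)) L (IsCMField.complexConj L) 2).Adelic) * y) ∈ tsupport f → cl β ∈ S) →
          ∃ T₀ : ℝ≥0, ∀ T : ℝ≥0, T₀ < T →
            (∀ p ∈ S, Integrable ((quasiSplit (↥(maximalRealSubfield L)) L (IsCMField.complexConj L) 2).quotFun (truncatedKernelClass ν 𝓕 T cl p f)) μ) ∧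
            (∀ x : (quasiSplit (↥(maximalRealSubfield L)) L (IsCMField.complexConj L) 2).Adelic, truncatedKernel ν 𝓕 T f x = ∑ p ∈ S, truncatedKernelClass ν 𝓕 T cl p f x) ∧
            truncatedTrace μ ν 𝓕 T f = ∑ p ∈ S, truncatedTraceClass μ ν 𝓕 T cl p f := by
  intro mN bN ν hν 𝓕 h𝓕 μ hμ f hf S hS hSB
  have hc : IsCMField.complexConj L * IsCMField.complexConj L = 1 := complexConj_mul_complexConj L
  have hfc : Continuous f := hf.continuous'
  have hfs : HasCompactSupport f := hf.hasCompactSupport'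
  -- Tate's fundamental domain on the line `N(𝔸) ≅ 𝔸_E⁻`, compactly contained (★ H-B1a; FD-independence moves `𝓕` there and back)
  have hij : (((0 : Fin 2) : Fin 2) : ℕ) + 1 = (((1 : Fin 2) : Fin 2) : ℕ) := rfl
  have hN2 : 2 = 2 * (((0 : Fin 2) : Fin 2) : ℕ) + 2 := rfl
  letI : MeasurableSpace (AdeleRing (𝓞 L) L) := borel _
  haveI : BorelSpace (AdeleRing (𝓞 L) L) := ⟨rfl⟩
  set 𝓕₀ : Set (adelicUnipotent (↥(maximalRealSubfield L)) L (IsCMField.complexConj L) 2) :=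
    (fun b : ↥(traceZeroAdele (↥(maximalRealSubfield L)) L (IsCMField.complexConj L)) =>
      middleRootUnipotent hij hN2 (Multiplicative.ofAdd b)) ''
        traceZeroFundamentalDomain (↥(maximalRealSubfield L)) L (IsCMField.complexConj L) with h𝓕₀_def
  have h𝓕₀ : IsFundamentalDomain (rationalUnipotent (↥(maximalRealSubfield L)) L (IsCMField.complexConj L) 2) 𝓕₀ ν :=
    isFundamentalDomain_image_traceZeroFundamentalDomain_two hij hN2 hc ν
  obtain ⟨W₀, hW₀, h𝓕₀W₀⟩ := exists_isCompact_image_traceZeroFundamentalDomain_subset_two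
    (F := ↥(maximalRealSubfield L)) (E := L) (c := IsCMField.complexConj L) hij hN2 hc
  -- per-class thresholds, maxed over the finite set
  have hint := fun p => truncatedKernelClassIntegrable_cm_two L hcl hclN ν 𝓕 h𝓕 μ f hf p
  choose T₀ hT₀ using hint
  refine ⟨S.sup T₀, fun T hT => ?_⟩
  have hTpos : 0 < T := lt_of_le_of_lt bot_le hT
  have hintS : ∀ p ∈ S, Integrable ((quasiSplit (↥(maximalRealSubfield L)) L (IsCMField.complexConj L) 2).quotFun (truncatedKernelClass ν 𝓕 T cl p f)) μ :=
    fun p hp => hT₀ p T (lt_of_le_of_lt (Finset.le_sup hp) hT)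
  -- the pointwise expansion at `𝓕₀`, transported to `𝓕`
  have hk₀ : ∀ x : (quasiSplit (↥(maximalRealSubfield L)) L (IsCMField.complexConj L) 2).Adelic,
      truncatedKernel ν 𝓕₀ T f x = ∑ p ∈ S, truncatedKernelClass ν 𝓕₀ T cl p f x :=
    fun x => truncatedKernel_eq_sum_truncatedKernelClass_of_tsupport_two ν h𝓕₀ hW₀ h𝓕₀W₀ cl hfc hfs S hTpos
      (fun γ x hγ => hS γ x hγ) (fun β u y _ hβ => hSB β u y hβ) x
  have hkk : truncatedKernel ν 𝓕 T f = truncatedKernel ν 𝓕₀ T f :=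
    truncatedKernel_eq_of_isFundamentalDomain ν ν h𝓕 h𝓕₀ T f
  have hkc : ∀ p, truncatedKernelClass ν 𝓕 T cl p f = truncatedKernelClass ν 𝓕₀ T cl p f :=
    fun p => truncatedKernelClass_eq_of_isFundamentalDomain_two ν ν h𝓕 h𝓕₀ hclN T p f
  have hk : ∀ x : (quasiSplit (↥(maximalRealSubfield L)) L (IsCMField.complexConj L) 2).Adelic, truncatedKernel ν 𝓕 T f x = ∑ p ∈ S, truncatedKernelClass ν 𝓕 T cl p f x := by
    intro x
    rw [hkk, hk₀ x]
    exact Finset.sum_congr rfl fun p _ => by rw [hkc p]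
  exact ⟨hintS, hk, truncatedTrace_eq_sum_truncatedTraceClass μ T cl S hk hintS⟩

/-! ## §2 LAW 3 for an admissible class map: `J^T(f) = Σ_{𝔬 ∈ S} p_𝔬(log T)`, `J(f) = Σ_{𝔬 ∈ S} p_𝔬(0)` -/

/-- **LAW 3, closed form, for an arbitrary admissible class map** at the CM pair: with `S` as in §1 there are class
polynomials `p_𝔬 ∈ ℂ[X]` ALL of degree `≤ 1` (★ `truncatedTraceClassPolynomial_two_cm`, generic in `cl`) and a
threshold `T₀` with, for all `T > T₀`: `J^T_𝔬(f) = p_𝔬(log T)` for `𝔬 ∈ S` and `J^T(f) = Σ_{𝔬 ∈ S} p_𝔬(log T)`.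
[cite: Rogawski1990, §2.2 (p. 13)] [cite: Arthur1981TraceFormulaInvariantForm, Prop. 2.3]
[cite: Shokranian1992, Thm. (5.7) and Rem. (5.8)] -/
theorem truncatedTrace_eq_sum_eval_classPolynomial_cm_of_covering_two (L : Type) [Field L] [NumberField L] [IsCMField L]
    {ι : Type u} {cl : ↥(quasiSplit (↥(maximalRealSubfield L)) L (IsCMField.complexConj L) 2).arithmeticSubgroup → ι} (hcl : IsConjInvariant cl)
    (hclN : IsUnipotentInvariantOnBorel (↥(maximalRealSubfield L)) L (IsCMField.complexConj L) 2 cl) :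
    ∀ [MeasurableSpace (adelicUnipotent (↥(maximalRealSubfield L)) L (IsCMField.complexConj L) 2)]
      [BorelSpace (adelicUnipotent (↥(maximalRealSubfield L)) L (IsCMField.complexConj L) 2)]
      (ν : Measure (adelicUnipotent (↥(maximalRealSubfield L)) L (IsCMField.complexConj L) 2)) [ν.IsHaarMeasure]
      (𝓕 : Set (adelicUnipotent (↥(maximalRealSubfield L)) L (IsCMField.complexConj L) 2)),
      IsFundamentalDomain (rationalUnipotent (↥(maximalRealSubfield L)) L (IsCMField.complexConj L) 2) 𝓕 ν →
        ∀ (μ : Measure (quasiSplit (↥(maximalRealSubfield L)) L (IsCMField.complexConj L) 2).automorphicQuotient)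
          [(quasiSplit (↥(maximalRealSubfield L)) L (IsCMField.complexConj L) 2).IsAutomorphicMeasure μ]
          (f : (quasiSplit (↥(maximalRealSubfield L)) L (IsCMField.complexConj L) 2).Adelic → ℂ),
          IsQuasiSplitTest (↥(maximalRealSubfield L)) L (IsCMField.complexConj L) 2 f →
          ∀ (S : Finset ι),
            (∀ (γ : ↥(quasiSplit (↥(maximalRealSubfield L)) L (IsCMField.complexConj L) 2).arithmeticSubgroup) (x : (quasiSplit (↥(maximalRealSubfield L)) L (IsCMField.complexConj L) 2).Adelic),
              x⁻¹ * (γ : (quasiSplit (↥(maximalRealSubfield L)) L (IsCMField.complexConj L) 2).Adelic) * x ∈ tsupport f → cl γ ∈ S) →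
            (∀ (β : ↥(arithmeticBorel (↥(maximalRealSubfield L)) L (IsCMField.complexConj L) 2)) (u : ↥(adelicUnipotent (↥(maximalRealSubfield L)) L (IsCMField.complexConj L) 2)) (y : (quasiSplit (↥(maximalRealSubfield L)) L (IsCMField.complexConj L) 2).Adelic),
              y⁻¹ * (((β : ↥(quasiSplit (↥(maximalRealSubfield L)) L (IsCMField.complexConj L) 2).arithmeticSubgroup)) : (quasiSplit (↥(maximalRealSubfield L)) L (IsCMField.complexConj L) 2).Adelic) * ((u : (quasiSplit (↥(maximalRealSubfield L)) L (IsCMField.complexConj L) 2).Adelic) * y) ∈ tsupport f → cl β ∈ S) →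
          ∃ P : ι → ℂ[X],
            (∀ i, (P i).natDegree ≤ 1) ∧ ∃ T₀ : ℝ≥0, ∀ T : ℝ≥0, T₀ < T →
              (∀ i ∈ S, truncatedTraceClass μ ν 𝓕 T cl i f = (P i).eval ((Real.log (T : ℝ) : ℝ) : ℂ)) ∧
              truncatedTrace μ ν 𝓕 T f = ∑ i ∈ S, (P i).eval ((Real.log (T : ℝ) : ℝ) : ℂ) := by
  intro mN bN ν hν 𝓕 h𝓕 μ hμ f hf S hS hSB
  obtain ⟨T₁, hT₁⟩ := truncatedTrace_eq_sum_truncatedTraceClass_cm_of_covering_two L hcl hclN ν 𝓕 h𝓕 μ f hf S hS hSB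
  have hP := fun i => truncatedTraceClassPolynomial_two_cm L hcl hclN i ν 𝓕 h𝓕 μ f hf
  choose P hPdeg T₀ hT₀ using hP
  refine ⟨P, hPdeg, max T₁ (S.sup T₀), fun T hT => ?_⟩
  have h1 : ∀ i ∈ S, truncatedTraceClass μ ν 𝓕 T cl i f = (P i).eval ((Real.log (T : ℝ) : ℝ) : ℂ) :=
    fun i hi => hT₀ i T (lt_of_le_of_lt ((Finset.le_sup hi).trans (le_max_right _ _)) hT)
  refine ⟨h1, ?_⟩
  rw [(hT₁ T (lt_of_le_of_lt (le_max_left _ _) hT)).2.2]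
  exact Finset.sum_congr rfl h1

/-- **LAW 3, constant term, for an arbitrary admissible class map** at the CM pair: with the class polynomials of the
previous theorem, `Σ_{𝔬 ∈ S} p_𝔬` computes `J^T(f)`, it IS Arthur's polynomial `truncatedTracePolynomial μ ν 𝓕 f`
(degree `≤ 1`), and **`J(f) = arthurTrace μ ν 𝓕 f = Σ_{𝔬 ∈ S} p_𝔬(0)`**. [cite: Rogawski1990, §2.2 (p. 13)]
[cite: Arthur1981TraceFormulaInvariantForm, Prop. 2.3] [cite: Shokranian1992, §5.2] -/
theorem arthurTrace_eq_sum_classPolynomial_eval_zero_cm_of_covering_two (L : Type) [Field L] [NumberField L] [IsCMField L]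
    {ι : Type u} {cl : ↥(quasiSplit (↥(maximalRealSubfield L)) L (IsCMField.complexConj L) 2).arithmeticSubgroup → ι} (hcl : IsConjInvariant cl)
    (hclN : IsUnipotentInvariantOnBorel (↥(maximalRealSubfield L)) L (IsCMField.complexConj L) 2 cl) :
    ∀ [MeasurableSpace (adelicUnipotent (↥(maximalRealSubfield L)) L (IsCMField.complexConj L) 2)]
      [BorelSpace (adelicUnipotent (↥(maximalRealSubfield L)) L (IsCMField.complexConj L) 2)]
      (ν : Measure (adelicUnipotent (↥(maximalRealSubfield L)) L (IsCMField.complexConj L) 2)) [ν.IsHaarMeasure]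
      (𝓕 : Set (adelicUnipotent (↥(maximalRealSubfield L)) L (IsCMField.complexConj L) 2)),
      IsFundamentalDomain (rationalUnipotent (↥(maximalRealSubfield L)) L (IsCMField.complexConj L) 2) 𝓕 ν →
        ∀ (μ : Measure (quasiSplit (↥(maximalRealSubfield L)) L (IsCMField.complexConj L) 2).automorphicQuotient)
          [(quasiSplit (↥(maximalRealSubfield L)) L (IsCMField.complexConj L) 2).IsAutomorphicMeasure μ]
          (f : (quasiSplit (↥(maximalRealSubfield L)) L (IsCMField.complexConj L) 2).Adelic → ℂ),
          IsQuasiSplitTest (↥(maximalRealSubfield L)) L (IsCMField.complexConj L) 2 f →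
          ∀ (S : Finset ι),
            (∀ (γ : ↥(quasiSplit (↥(maximalRealSubfield L)) L (IsCMField.complexConj L) 2).arithmeticSubgroup) (x : (quasiSplit (↥(maximalRealSubfield L)) L (IsCMField.complexConj L) 2).Adelic),
              x⁻¹ * (γ : (quasiSplit (↥(maximalRealSubfield L)) L (IsCMField.complexConj L) 2).Adelic) * x ∈ tsupport f → cl γ ∈ S) →
            (∀ (β : ↥(arithmeticBorel (↥(maximalRealSubfield L)) L (IsCMField.complexConj L) 2)) (u : ↥(adelicUnipotent (↥(maximalRealSubfield L)) L (IsCMField.complexConj L) 2)) (y : (quasiSplit (↥(maximalRealSubfield L)) L (IsCMField.complexConj L) 2).Adelic),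
              y⁻¹ * (((β : ↥(quasiSplit (↥(maximalRealSubfield L)) L (IsCMField.complexConj L) 2).arithmeticSubgroup)) : (quasiSplit (↥(maximalRealSubfield L)) L (IsCMField.complexConj L) 2).Adelic) * ((u : (quasiSplit (↥(maximalRealSubfield L)) L (IsCMField.complexConj L) 2).Adelic) * y) ∈ tsupport f → cl β ∈ S) →
          ∃ P : ι → ℂ[X],
            (∀ i, (P i).natDegree ≤ 1) ∧
            (∀ i ∈ S, ∃ T₀ : ℝ≥0, ∀ T : ℝ≥0, T₀ < T →
              truncatedTraceClass μ ν 𝓕 T cl i f = (P i).eval ((Real.log (T : ℝ) : ℝ) : ℂ)) ∧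
            IsTruncatedTracePolynomial μ ν 𝓕 f (∑ i ∈ S, P i) ∧
            (∑ i ∈ S, P i).natDegree ≤ 1 ∧
            truncatedTracePolynomial μ ν 𝓕 f = ∑ i ∈ S, P i ∧
            arthurTrace μ ν 𝓕 f = ∑ i ∈ S, (P i).eval 0 := by
  intro mN bN ν hν 𝓕 h𝓕 μ hμ f hf S hS hSB
  obtain ⟨P, hPdeg, T₀, hT₀⟩ :=
    truncatedTrace_eq_sum_eval_classPolynomial_cm_of_covering_two L hcl hclN ν 𝓕 h𝓕 μ f hf S hS hSB
  have hpoly : IsTruncatedTracePolynomial μ ν 𝓕 f (∑ i ∈ S, P i) :=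
    ⟨T₀, fun T hT => by rw [(hT₀ T hT).2, eval_finsetSum]⟩
  exact ⟨P, hPdeg, fun i hi => ⟨T₀, fun T hT => (hT₀ T hT).1 i hi⟩, hpoly,
    natDegree_sum_le_of_forall_le _ _ fun i _ => hPdeg i, truncatedTracePolynomial_eq hpoly,
    by rw [arthurTrace_eq_eval hpoly, eval_finsetSum]⟩

/-! ## §3 The split at `B(F)` for an admissible class map: `J(f) = Σ_{𝔬 ∈ S, 𝔬 ∩ B = ∅} J^T_𝔬(f) + Σ_{𝔬 ∈ S, 𝔬 ∩ B ≠ ∅} p_𝔬(0)` -/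

/-- **The constant term of the fine `𝔬`-expansion, split at `B(L⁺)`, for an arbitrary admissible class map** at the
CM pair: with `S` and the class polynomials `p_𝔬` of §2 (degree `≤ 1`, computing `J^T_𝔬(f)` above a threshold,
summing to Arthur's polynomial), the class polynomials of the classes MISSING `B(L⁺)` are the constants
`C (J^T_𝔬(f))` (★ `classPolynomial_eq_C_of_forall_ne`, any `T`) and, for EVERY `T`,
`J(f) = Σ_{𝔬 ∈ S, ∀ β ∈ B(L⁺), cl β ≠ 𝔬} J^T_𝔬(f) + Σ_{𝔬 ∈ S, ¬ …} p_𝔬(0)`. [cite: Rogawski1990, §2.2–2.3 (pp. 13–14)]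
[cite: Arthur1981TraceFormulaInvariantForm, Prop. 2.3] [cite: Shokranian1992, §5.2] -/
theorem arthurTrace_eq_sum_offBorel_add_sum_cm_of_covering_two (L : Type) [Field L] [NumberField L] [IsCMField L]
    {ι : Type u} {cl : ↥(quasiSplit (↥(maximalRealSubfield L)) L (IsCMField.complexConj L) 2).arithmeticSubgroup → ι} (hcl : IsConjInvariant cl)
    (hclN : IsUnipotentInvariantOnBorel (↥(maximalRealSubfield L)) L (IsCMField.complexConj L) 2 cl) :
    ∀ [MeasurableSpace (adelicUnipotent (↥(maximalRealSubfield L)) L (IsCMField.complexConj L) 2)]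
      [BorelSpace (adelicUnipotent (↥(maximalRealSubfield L)) L (IsCMField.complexConj L) 2)]
      (ν : Measure (adelicUnipotent (↥(maximalRealSubfield L)) L (IsCMField.complexConj L) 2)) [ν.IsHaarMeasure]
      (𝓕 : Set (adelicUnipotent (↥(maximalRealSubfield L)) L (IsCMField.complexConj L) 2)),
      IsFundamentalDomain (rationalUnipotent (↥(maximalRealSubfield L)) L (IsCMField.complexConj L) 2) 𝓕 ν →
        ∀ (μ : Measure (quasiSplit (↥(maximalRealSubfield L)) L (IsCMField.complexConj L) 2).automorphicQuotient)
          [(quasiSplit (↥(maximalRealSubfield L)) L (IsCMField.complexConj L) 2).IsAutomorphicMeasure μ]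
          (f : (quasiSplit (↥(maximalRealSubfield L)) L (IsCMField.complexConj L) 2).Adelic → ℂ),
          IsQuasiSplitTest (↥(maximalRealSubfield L)) L (IsCMField.complexConj L) 2 f →
          ∀ (S : Finset ι),
            (∀ (γ : ↥(quasiSplit (↥(maximalRealSubfield L)) L (IsCMField.complexConj L) 2).arithmeticSubgroup) (x : (quasiSplit (↥(maximalRealSubfield L)) L (IsCMField.complexConj L) 2).Adelic),
              x⁻¹ * (γ : (quasiSplit (↥(maximalRealSubfield L)) L (IsCMField.complexConj L) 2).Adelic) * x ∈ tsupport f → cl γ ∈ S) →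
            (∀ (β : ↥(arithmeticBorel (↥(maximalRealSubfield L)) L (IsCMField.complexConj L) 2)) (u : ↥(adelicUnipotent (↥(maximalRealSubfield L)) L (IsCMField.complexConj L) 2)) (y : (quasiSplit (↥(maximalRealSubfield L)) L (IsCMField.complexConj L) 2).Adelic),
              y⁻¹ * (((β : ↥(quasiSplit (↥(maximalRealSubfield L)) L (IsCMField.complexConj L) 2).arithmeticSubgroup)) : (quasiSplit (↥(maximalRealSubfield L)) L (IsCMField.complexConj L) 2).Adelic) * ((u : (quasiSplit (↥(maximalRealSubfield L)) L (IsCMField.complexConj L) 2).Adelic) * y) ∈ tsupport f → cl β ∈ S) →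
          ∃ P : ι → ℂ[X],
            (∀ i, (P i).natDegree ≤ 1) ∧
            (∀ i ∈ S, ∃ T₀ : ℝ≥0, ∀ T : ℝ≥0, T₀ < T →
              truncatedTraceClass μ ν 𝓕 T cl i f = (P i).eval ((Real.log (T : ℝ) : ℝ) : ℂ)) ∧
            truncatedTracePolynomial μ ν 𝓕 f = ∑ i ∈ S, P i ∧
            (∀ i ∈ S, (∀ β : ↥(arithmeticBorel (↥(maximalRealSubfield L)) L (IsCMField.complexConj L) 2), cl β ≠ i) →
              ∀ T : ℝ≥0, P i = C (truncatedTraceClass μ ν 𝓕 T cl i f)) ∧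
            ∀ T : ℝ≥0, arthurTrace μ ν 𝓕 f =
              (∑ i ∈ S.filter (fun i => ∀ β : ↥(arithmeticBorel (↥(maximalRealSubfield L)) L (IsCMField.complexConj L) 2), cl β ≠ i), truncatedTraceClass μ ν 𝓕 T cl i f) +
              ∑ i ∈ S.filter (fun i => ¬ ∀ β : ↥(arithmeticBorel (↥(maximalRealSubfield L)) L (IsCMField.complexConj L) 2), cl β ≠ i), (P i).eval 0 := by
  intro mN bN ν hν 𝓕 h𝓕 μ hμ f hf S hS hSB
  obtain ⟨P, hPdeg, hP, -, -, hpoly, harthur⟩ :=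
    arthurTrace_eq_sum_classPolynomial_eval_zero_cm_of_covering_two L hcl hclN ν 𝓕 h𝓕 μ f hf S hS hSB
  -- the off-`B(L⁺)` class polynomials are constants
  have hC : ∀ i ∈ S, (∀ β : ↥(arithmeticBorel (↥(maximalRealSubfield L)) L (IsCMField.complexConj L) 2), cl β ≠ i) →
      ∀ T : ℝ≥0, P i = C (truncatedTraceClass μ ν 𝓕 T cl i f) := by
    intro i hi hiB T
    obtain ⟨T₀, hT₀⟩ := hP i hi
    exact classPolynomial_eq_C_of_forall_ne hiB hT₀ ν 𝓕 T
  refine ⟨P, hPdeg, hP, hpoly, hC, fun T => ?_⟩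
  rw [harthur, ← Finset.sum_filter_add_sum_filter_not S (fun i => ∀ β : ↥(arithmeticBorel (↥(maximalRealSubfield L)) L (IsCMField.complexConj L) 2), cl β ≠ i)]
  congr 1
  refine Finset.sum_congr rfl fun i hi => ?_
  rw [Finset.mem_filter] at hi
  rw [hC i hi.1 hi.2 T, eval_C]

/-! ## §4 LAW 4 fold for an admissible class map: the off-`B(L⁺)` classes as orbital integrals with covolume weights -/

/-- **`J(f) = Σ_{𝔬 ∈ S, 𝔬 ∩ B = ∅} c_μ Σ'_{s ⊆ 𝔬} vol(G_{γ_s}(L⁺)∖G_{γ_s}(𝔸)) · Φ_{ν∕ν_s}(γ_s, f) + Σ_{𝔬 ∈ S, 𝔬 ∩ B ≠ ∅} p_𝔬(0)`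
for an arbitrary admissible class map** at the CM pair (NO hypothesis beyond the letters: `μ` automorphic, `ν₀` a Haar
measure of `N(𝔸)` with a fundamental domain `𝓕` of `N(L⁺)`, `ν` a Haar measure of `G(𝔸)`, `rep` representatives of the
`G(L⁺)`-conjugacy classes, `ν_s` Haar measures of the centralisers, `f` a test function, `S` a finite live set with the
two coverings): §3 with each off-`B(L⁺)` term rewritten by ★ (L4-d)
`truncatedTraceClass_eq_mul_tsum_covol_mul_orbitalIntegral_cm_two` (generic in `cl`), the two-sidedness ∕ inversion invariance
of the centraliser measures installed per summand from the membership proof (★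
`isMulRightInvariant_centralizer_of_forall_cl_ne`, ★ `isInvInvariant_centralizer_of_forall_cl_ne`) over the ATTACHED
filter, as in ★ `arthurTrace_eq_sum_orbital_add_sum_charpoly_cm_two`. [cite: Rogawski1990, §2.2–2.3 (pp. 13–14)]
[cite: Arthur1978TraceFormulaI, §8] [cite: Gelbart1975, (9.13) and Thm. 9.22 (ii)] -/
theorem arthurTrace_eq_sum_orbital_add_sum_cm_of_covering_two (L : Type) [Field L] [NumberField L] [IsCMField L]
    [instMA : MeasurableSpace (quasiSplit (↥(maximalRealSubfield L)) L (IsCMField.complexConj L) 2).Adelic] [instBA : BorelSpace (quasiSplit (↥(maximalRealSubfield L)) L (IsCMField.complexConj L) 2).Adelic]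
    [instMU : MeasurableSpace (adelicUnipotent (↥(maximalRealSubfield L)) L (IsCMField.complexConj L) 2)]
    [instBU : BorelSpace (adelicUnipotent (↥(maximalRealSubfield L)) L (IsCMField.complexConj L) 2)]
    [instMQ : ∀ γ : (quasiSplit (↥(maximalRealSubfield L)) L (IsCMField.complexConj L) 2).Adelic,
      MeasurableSpace ((quasiSplit (↥(maximalRealSubfield L)) L (IsCMField.complexConj L) 2).Adelic ⧸
        Subgroup.centralizer ({γ} : Set (quasiSplit (↥(maximalRealSubfield L)) L (IsCMField.complexConj L) 2).Adelic))]
    [instBQ : ∀ γ : (quasiSplit (↥(maximalRealSubfield L)) L (IsCMField.complexConj L) 2).Adelic,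
      BorelSpace ((quasiSplit (↥(maximalRealSubfield L)) L (IsCMField.complexConj L) 2).Adelic ⧸
        Subgroup.centralizer ({γ} : Set (quasiSplit (↥(maximalRealSubfield L)) L (IsCMField.complexConj L) 2).Adelic))]
    [instMS : ∀ γ : (quasiSplit (↥(maximalRealSubfield L)) L (IsCMField.complexConj L) 2).Adelic,
      MeasurableSpace (↥(Subgroup.centralizer ({γ} : Set (quasiSplit (↥(maximalRealSubfield L)) L (IsCMField.complexConj L) 2).Adelic)) ⧸
        ((quasiSplit (↥(maximalRealSubfield L)) L (IsCMField.complexConj L) 2).quotientSubgroup ⊓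
          Subgroup.centralizer ({γ} : Set (quasiSplit (↥(maximalRealSubfield L)) L (IsCMField.complexConj L) 2).Adelic)).subgroupOf
          (Subgroup.centralizer ({γ} : Set (quasiSplit (↥(maximalRealSubfield L)) L (IsCMField.complexConj L) 2).Adelic)))]
    [instBS : ∀ γ : (quasiSplit (↥(maximalRealSubfield L)) L (IsCMField.complexConj L) 2).Adelic,
      BorelSpace (↥(Subgroup.centralizer ({γ} : Set (quasiSplit (↥(maximalRealSubfield L)) L (IsCMField.complexConj L) 2).Adelic)) ⧸
        ((quasiSplit (↥(maximalRealSubfield L)) L (IsCMField.complexConj L) 2).quotientSubgroup ⊓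
          Subgroup.centralizer ({γ} : Set (quasiSplit (↥(maximalRealSubfield L)) L (IsCMField.complexConj L) 2).Adelic)).subgroupOf
          (Subgroup.centralizer ({γ} : Set (quasiSplit (↥(maximalRealSubfield L)) L (IsCMField.complexConj L) 2).Adelic)))]
    {ι : Type u} {cl : ↥(quasiSplit (↥(maximalRealSubfield L)) L (IsCMField.complexConj L) 2).arithmeticSubgroup → ι} (hcl : IsConjInvariant cl)
    (hclN : IsUnipotentInvariantOnBorel (↥(maximalRealSubfield L)) L (IsCMField.complexConj L) 2 cl)
    (ν₀ : Measure (adelicUnipotent (↥(maximalRealSubfield L)) L (IsCMField.complexConj L) 2)) [instν₀ : ν₀.IsHaarMeasure]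
    (𝓕 : Set (adelicUnipotent (↥(maximalRealSubfield L)) L (IsCMField.complexConj L) 2))
    (h𝓕 : IsFundamentalDomain (rationalUnipotent (↥(maximalRealSubfield L)) L (IsCMField.complexConj L) 2) 𝓕 ν₀)
    (μ : Measure (quasiSplit (↥(maximalRealSubfield L)) L (IsCMField.complexConj L) 2).automorphicQuotient)
    [instμ : (quasiSplit (↥(maximalRealSubfield L)) L (IsCMField.complexConj L) 2).IsAutomorphicMeasure μ]
    (ν : Measure (quasiSplit (↥(maximalRealSubfield L)) L (IsCMField.complexConj L) 2).Adelic) [instν : IsHaarMeasure ν]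
    (rep : ConjClasses ↥(quasiSplit (↥(maximalRealSubfield L)) L (IsCMField.complexConj L) 2).arithmeticSubgroup → ↥(quasiSplit (↥(maximalRealSubfield L)) L (IsCMField.complexConj L) 2).arithmeticSubgroup)
    (hrep : ∀ s, ConjClasses.mk (rep s) = s)
    (νC : ∀ s : ConjClasses ↥(quasiSplit (↥(maximalRealSubfield L)) L (IsCMField.complexConj L) 2).arithmeticSubgroup,
      Measure ↥(Subgroup.centralizer ({((rep s : ↥(quasiSplit (↥(maximalRealSubfield L)) L (IsCMField.complexConj L) 2).arithmeticSubgroup) : (quasiSplit (↥(maximalRealSubfield L)) L (IsCMField.complexConj L) 2).Adelic)} : Set (quasiSplit (↥(maximalRealSubfield L)) L (IsCMField.complexConj L) 2).Adelic)))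
    [instνC : ∀ s, IsHaarMeasure (νC s)]
    (f : (quasiSplit (↥(maximalRealSubfield L)) L (IsCMField.complexConj L) 2).Adelic → ℂ)
    (hf : IsQuasiSplitTest (↥(maximalRealSubfield L)) L (IsCMField.complexConj L) 2 f)
    (S : Finset ι)
    (hS : ∀ (γ : ↥(quasiSplit (↥(maximalRealSubfield L)) L (IsCMField.complexConj L) 2).arithmeticSubgroup) (x : (quasiSplit (↥(maximalRealSubfield L)) L (IsCMField.complexConj L) 2).Adelic),
      x⁻¹ * (γ : (quasiSplit (↥(maximalRealSubfield L)) L (IsCMField.complexConj L) 2).Adelic) * x ∈ tsupport f → cl γ ∈ S)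
    (hSB : ∀ (β : ↥(arithmeticBorel (↥(maximalRealSubfield L)) L (IsCMField.complexConj L) 2)) (u : ↥(adelicUnipotent (↥(maximalRealSubfield L)) L (IsCMField.complexConj L) 2)) (y : (quasiSplit (↥(maximalRealSubfield L)) L (IsCMField.complexConj L) 2).Adelic),
      y⁻¹ * (((β : ↥(quasiSplit (↥(maximalRealSubfield L)) L (IsCMField.complexConj L) 2).arithmeticSubgroup)) : (quasiSplit (↥(maximalRealSubfield L)) L (IsCMField.complexConj L) 2).Adelic) * ((u : (quasiSplit (↥(maximalRealSubfield L)) L (IsCMField.complexConj L) 2).Adelic) * y) ∈ tsupport f → cl β ∈ S) :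
    haveI := t2Space_quasiSplitAdelic (F := ↥(maximalRealSubfield L)) (E := L) (c := IsCMField.complexConj L) (N := 2)
    haveI := locallyCompactSpace_quasiSplitAdelic (F := ↥(maximalRealSubfield L)) (E := L) (c := IsCMField.complexConj L) (N := 2)
    haveI := secondCountableTopology_quasiSplitAdelic (F := ↥(maximalRealSubfield L)) (E := L) (c := IsCMField.complexConj L) (N := 2)
    haveI : IsClosed (((quasiSplit (↥(maximalRealSubfield L)) L (IsCMField.complexConj L) 2).quotientSubgroup : Set (quasiSplit (↥(maximalRealSubfield L)) L (IsCMField.complexConj L) 2).Adelic)) :=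
      isClosed_quotientSubgroup_quasiSplit
    haveI : ∀ γ : (quasiSplit (↥(maximalRealSubfield L)) L (IsCMField.complexConj L) 2).Adelic, IsClosed ((Subgroup.centralizer ({γ} : Set (quasiSplit (↥(maximalRealSubfield L)) L (IsCMField.complexConj L) 2).Adelic) :
        Subgroup (quasiSplit (↥(maximalRealSubfield L)) L (IsCMField.complexConj L) 2).Adelic) : Set (quasiSplit (↥(maximalRealSubfield L)) L (IsCMField.complexConj L) 2).Adelic) := isClosed_centralizer_quasiSplit
    haveI : ∀ γ : (quasiSplit (↥(maximalRealSubfield L)) L (IsCMField.complexConj L) 2).Adelic, (count : Measure ↥(((quasiSplit (↥(maximalRealSubfield L)) L (IsCMField.complexConj L) 2).quotientSubgroup ⊓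
        Subgroup.centralizer ({γ} : Set (quasiSplit (↥(maximalRealSubfield L)) L (IsCMField.complexConj L) 2).Adelic)).subgroupOf
          (Subgroup.centralizer ({γ} : Set (quasiSplit (↥(maximalRealSubfield L)) L (IsCMField.complexConj L) 2).Adelic)))).IsHaarMeasure :=
      isHaarMeasure_count_inf_centralizer_subgroupOf_quasiSplit
    haveI : (count : Measure (quasiSplit (↥(maximalRealSubfield L)) L (IsCMField.complexConj L) 2).quotientSubgroup).IsHaarMeasure :=
      isHaarMeasure_count_quotientSubgroup_quasiSplit
    haveI : ν.IsMulRightInvariant := isMulRightInvariant_quasiSplit_cm_two L ν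
    letI := AdelicGroupData.measurableSpaceQuotientForm (quasiSplit (↥(maximalRealSubfield L)) L (IsCMField.complexConj L) 2)
    haveI := AdelicGroupData.borelSpaceQuotientForm (quasiSplit (↥(maximalRealSubfield L)) L (IsCMField.complexConj L) 2)
    haveI := AdelicGroupData.smulInvariantMeasureQuotientForm (quasiSplit (↥(maximalRealSubfield L)) L (IsCMField.complexConj L) 2) μ
    haveI := AdelicGroupData.isFiniteMeasureOnCompactsQuotientForm (quasiSplit (↥(maximalRealSubfield L)) L (IsCMField.complexConj L) 2) μ
    ∃ P : ι → ℂ[X],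
      (∀ i, (P i).natDegree ≤ 1) ∧
      (∀ i ∈ S, ∃ T₀ : ℝ≥0, ∀ T : ℝ≥0, T₀ < T →
        truncatedTraceClass μ ν₀ 𝓕 T cl i f = (P i).eval ((Real.log (T : ℝ) : ℝ) : ℂ)) ∧
      truncatedTracePolynomial μ ν₀ 𝓕 f = ∑ i ∈ S, P i ∧
      (∀ i ∈ S, (∀ β : ↥(arithmeticBorel (↥(maximalRealSubfield L)) L (IsCMField.complexConj L) 2), cl β ≠ i) →
        ∀ T : ℝ≥0, P i = C (truncatedTraceClass μ ν₀ 𝓕 T cl i f)) ∧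
      ∀ T : ℝ≥0, arthurTrace μ ν₀ 𝓕 f =
        (∑ i ∈ (S.filter (fun i => ∀ β : ↥(arithmeticBorel (↥(maximalRealSubfield L)) L (IsCMField.complexConj L) 2), cl β ≠ i)).attach,
          ((unfoldingConstant (quasiSplit (↥(maximalRealSubfield L)) L (IsCMField.complexConj L) 2).quotientSubgroup
              (count : Measure (quasiSplit (↥(maximalRealSubfield L)) L (IsCMField.complexConj L) 2).quotientSubgroup) μ ν : ℝ) : ℂ) *
            ∑' s : {s : ConjClasses ↥(quasiSplit (↥(maximalRealSubfield L)) L (IsCMField.complexConj L) 2).arithmeticSubgroup // cl (rep s) = i.1},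
              (haveI : (νC s.1).IsMulRightInvariant :=
                  isMulRightInvariant_centralizer_of_forall_cl_ne_two
                    hcl (Finset.mem_filter.1 i.2).2 s.2 (νC s.1);
                haveI : (νC s.1).IsInvInvariant :=
                  isInvInvariant_centralizer_of_forall_cl_ne_two
                    hcl (Finset.mem_filter.1 i.2).2 s.2 (νC s.1);
                ((quotientMeasure (((quasiSplit (↥(maximalRealSubfield L)) L (IsCMField.complexConj L) 2).quotientSubgroup ⊓
                    Subgroup.centralizer ({((rep s.1 : ↥(quasiSplit (↥(maximalRealSubfield L)) L (IsCMField.complexConj L) 2).arithmeticSubgroup) : (quasiSplit (↥(maximalRealSubfield L)) L (IsCMField.complexConj L) 2).Adelic)} : Set (quasiSplit (↥(maximalRealSubfield L)) L (IsCMField.complexConj L) 2).Adelic)).subgroupOf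
                    (Subgroup.centralizer ({((rep s.1 : ↥(quasiSplit (↥(maximalRealSubfield L)) L (IsCMField.complexConj L) 2).arithmeticSubgroup) : (quasiSplit (↥(maximalRealSubfield L)) L (IsCMField.complexConj L) 2).Adelic)} : Set (quasiSplit (↥(maximalRealSubfield L)) L (IsCMField.complexConj L) 2).Adelic)))
                    count (isClosed_inf_centralizer_subgroupOf_quasiSplit _) (νC s.1) Set.univ).toReal : ℂ) *
                  orbitalIntegral ((rep s.1 : ↥(quasiSplit (↥(maximalRealSubfield L)) L (IsCMField.complexConj L) 2).arithmeticSubgroup) : (quasiSplit (↥(maximalRealSubfield L)) L (IsCMField.complexConj L) 2).Adelic) f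
                    (quotientMeasure (Subgroup.centralizer ({((rep s.1 : ↥(quasiSplit (↥(maximalRealSubfield L)) L (IsCMField.complexConj L) 2).arithmeticSubgroup) : (quasiSplit (↥(maximalRealSubfield L)) L (IsCMField.complexConj L) 2).Adelic)} : Set (quasiSplit (↥(maximalRealSubfield L)) L (IsCMField.complexConj L) 2).Adelic)) (νC s.1)
                      (isClosed_centralizer_quasiSplit _) ν))) +
        ∑ i ∈ S.filter (fun i => ¬ ∀ β : ↥(arithmeticBorel (↥(maximalRealSubfield L)) L (IsCMField.complexConj L) 2), cl β ≠ i),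
          (P i).eval 0 := by
  have h3d := @arthurTrace_eq_sum_offBorel_add_sum_cm_of_covering_two L _ _ _ ι cl hcl hclN instMU instBU ν₀ instν₀ 𝓕 h𝓕 μ
    instμ f hf S hS hSB
  obtain ⟨P, hdeg, hP, hpoly, hC, hJ⟩ := h3d
  refine ⟨P, hdeg, hP, hpoly, hC, fun T => (hJ T).trans ?_⟩
  congr 1
  refine (Finset.sum_attach _ _).symm.trans (Finset.sum_congr rfl fun i _ => ?_)
  exact @truncatedTraceClass_eq_mul_tsum_covol_mul_orbitalIntegral_cm_two L _ _ _ instMA instBA instMU instMQ instBQ instMS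
    instBS μ instμ ν instν _ _ hcl i.1 rep hrep (fun s => νC s.1) (fun s => instνC s.1)
    (Finset.mem_filter.1 i.2).2 f hf ν₀ 𝓕 T

end UnitaryGroup

end Literature.NumberTheory.Automorphic
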